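import Summits.SmoothPoincare4.SmoothPoincare4.Theorems.ConvexBisectionAcyclicBisectionExistsCrossingNumberInvariance
import Literature.Topology.PlaneTopology.ChartParity
import HarnessLib

/-!
# The crossing number does not change when the chart is re-profiled (collar shrunk or recentred)
(wave 3, brick Z6-5 — a tool for the evaluation step (γ) of the missing lemma
`crossingNumber_eq_stdSymp` of node N1a `node_M3c_shadow_pageDehnTwist` (Picard–Lefschetz on
shadows) of stub `stub_modelsOnFibred_of_reach` = NF4, line `modp-braid-orbits`, crux
`ConvexBisection.AcyclicBisectionExists`, item stmt-SmoothPoincare4-10508; registered sub-goal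
`helper_crossingNumber_reprofile`)

For an annulus chart `φ` of a page and an increasing affine re-profiling `r ↦ k + m r` of the
transverse coordinate with `0 < m`, `|k| + m ≤ 1`, the RE-PROFILED chart
`φ_{k,m} (u, r) = φ (u, k + m r)` — whose core is the level curve `height = k` of `φ`, whose annulus
`φ(ℝ × (k − m, k + m))` and collar are those of `φ` shrunk towards that level, with the same
orientation — is again an annulus chart of the page (`reprofile_periodic`, `reprofile_mem_page`,
`reprofile_injOn`), and **`crossingNumber φ_{k,m} K = crossingNumber φ K`** for every loop `K` of
the page (`crossingNumber_reprofile`, `helper_crossingNumber_reprofile`; `crossingNumber_rescale`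
is the case `k = 0`).  So crossing numbers may be computed in a collar as thin as an argument
needs, around any level curve of the chart (e.g. a level meeting a given smooth loop
transversally, so thin that the loop makes clean passages through it — cf. the passage formula of
`…CrossingNumberPassages.lean`).

Proof: the phase loop of `K` for `φ_{k,m}` is `t ↦ exp (2πi χ((height φ (K e^{2πit}) − k) / m))`
(`phaseLoop_reprofile`; both sides are `1` wherever `|height − k| ≥ m/2`); along the segment
`(k_μ, m_μ) = (μ k, 1 − μ (1 − m))`, `μ ∈ [0, 1]`, these loops form a nonvanishing family jointly
continuous in `(μ, t)` (`continuousOn_reprofileFamily`: inside the open annulus through the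
continuity of the transverse coordinate on the page, `continuousWithinAt_height`; off it the
phase is locally `1`, the sub-annulus `φ(ℝ × [−1 + m/2, 1 − m/2])` being compact,
`isCompact_image_Icc`), so the winding number is constant
(`Literature.Topology.PlaneTopology.wind_eq_of_homotopy`).

Everything is proved; no definitions, no named facts, no `sorry`.  References: W. Fulton,
*Algebraic Topology: A First Course* (1995), §3 (homotopy invariance of winding numbers)
[Fulton1995]; B. Farb, D. Margalit, *A primer on mapping class groups* (2012), §6.1 [FarbMargalit2012].
-/

noncomputable section

set_option linter.dupNamespace false

open scoped Manifold ContDiff Topology Real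
open Set Function Metric Filter
open Literature.Topology.FourManifolds Literature.Topology.FourManifolds.LefschetzBase
  Literature.Topology.PlaneTopology

namespace Summit.SmoothPoincare4.SmoothPoincare4.Theorems.AcyclicBisectionExists.ModpBraidOrbits

variable {g : ℕ} {c : ℂ} {φ : ℝ × ℝ → Base g} {K : sphere (0 : EuclideanSpace ℝ (Fin 2)) 1 → Base g}

/-! ## §1 The re-profiled chart -/

/-- The re-profiled chart is `1`-periodic in the first variable. [folklore] -/
theorem reprofile_periodic (hφ1 : ∀ u r, φ (u + 1, r) = φ (u, r)) (k m : ℝ) :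
    ∀ u r, (fun p : ℝ × ℝ => φ (p.1, k + m * p.2)) (u + 1, r) =
      (fun p : ℝ × ℝ => φ (p.1, k + m * p.2)) (u, r) := fun u r => hφ1 u (k + m * r)

/-- The re-profiled chart takes values in the page. [folklore] -/
theorem reprofile_mem_page (hφp : ∀ p, φ p ∈ page g c) (k m : ℝ) :
    ∀ p, (fun p : ℝ × ℝ => φ (p.1, k + m * p.2)) p ∈ page g c := fun p => hφp (p.1, k + m * p.2)

/-- The rescaled chart (`k = 0`) has the same core curve. [folklore] -/
theorem rescale_core {a : sphere (0 : EuclideanSpace ℝ (Fin 2)) 1 → Base g}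
    (hφa : ∀ u, φ (u, 0) = a (circlePt u)) (m : ℝ) :
    ∀ u, (fun p : ℝ × ℝ => φ (p.1, 0 + m * p.2)) (u, 0) = a (circlePt u) := fun u => by
  simp only [mul_zero, add_zero, hφa]

/-- A re-profiled height stays in `(−1, 1)`. [folklore] -/
theorem affine_mem_Ioo {k m r : ℝ} (hm : 0 < m) (hkm : |k| + m ≤ 1) (hr : r ∈ Ioo (-1 : ℝ) 1) :
    k + m * r ∈ Ioo (-1 : ℝ) 1 := by
  obtain ⟨h1, h2⟩ := hr
  have hk := abs_le.1 (show |k| ≤ 1 - m by linarith)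
  constructor <;> nlinarith

/-- The re-profiled chart (`0 < m`, `|k| + m ≤ 1`) is injective on `[0, 1) × (−1, 1)`. [folklore] -/
theorem reprofile_injOn (hφi : InjOn φ (Ico (0 : ℝ) 1 ×ˢ Ioo (-1 : ℝ) 1)) {k m : ℝ} (hm : 0 < m)
    (hkm : |k| + m ≤ 1) :
    InjOn (fun p : ℝ × ℝ => φ (p.1, k + m * p.2)) (Ico (0 : ℝ) 1 ×ˢ Ioo (-1 : ℝ) 1) := by
  rintro ⟨u, r⟩ ⟨hu, hr⟩ ⟨u', r'⟩ ⟨hu', hr'⟩ h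
  have e := hφi (⟨hu, affine_mem_Ioo hm hkm hr⟩ : (u, k + m * r) ∈ Ico (0 : ℝ) 1 ×ˢ Ioo (-1 : ℝ) 1)
    (⟨hu', affine_mem_Ioo hm hkm hr'⟩ : (u', k + m * r') ∈ Ico (0 : ℝ) 1 ×ˢ Ioo (-1 : ℝ) 1) h
  simp only [Prod.mk.injEq, add_right_inj] at e
  exact Prod.ext e.1 (mul_left_cancel₀ hm.ne' e.2)

/-! ## §2 The phase loop of the re-profiled chart -/

/-- `exp (2πi χ(x)) = 1` as soon as `|x| ≥ 1/2` (`χ ∈ {0, 1}` there). [folklore] -/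
theorem exp_clampStep_eq_one {x : ℝ} (hx : 1 / 2 ≤ |x|) :
    Complex.exp (((2 * π * clampStep x : ℝ) : ℂ) * Complex.I) = 1 := by
  rcases le_abs'.1 hx with h | h
  · rw [clampStep_of_le h, mul_zero, Complex.ofReal_zero, zero_mul, Complex.exp_zero]
  · rw [clampStep_of_ge h, mul_one]
    exact_mod_cast Complex.exp_two_pi_mul_I

/-- **The phase loop of the re-profiled chart** `φ_{k,m}`, `0 < m`, `|k| + m ≤ 1`:
`t ↦ exp (2πi χ((height φ (K e^{2πit}) − k) / m))`. [folklore] -/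
theorem phaseLoop_reprofile (hφ1 : ∀ u r, φ (u + 1, r) = φ (u, r))
    (hφi : InjOn φ (Ico (0 : ℝ) 1 ×ˢ Ioo (-1 : ℝ) 1)) {k m : ℝ} (hm : 0 < m) (hkm : |k| + m ≤ 1)
    (t : ℝ) :
    phaseLoop (fun p : ℝ × ℝ => φ (p.1, k + m * p.2)) K t =
      Complex.exp (((2 * π * clampStep ((height φ (K (circlePt t)) - k) / m) : ℝ) : ℂ) *
        Complex.I) := by
  rw [phaseLoop]
  by_cases hA : K (circlePt t) ∈ (fun p : ℝ × ℝ => φ (p.1, k + m * p.2)) '' (univ ×ˢ Ioo (-1 : ℝ) 1)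
  · obtain ⟨p, ⟨-, hp⟩, hpq⟩ := hA
    rw [← hpq, height_of_lift (reprofile_periodic hφ1 k m) (reprofile_injOn hφi hm hkm)
      (u₀ := p.1) (r₀ := p.2) hp]
    have e : height φ (φ (p.1, k + m * p.2)) = k + m * p.2 :=
      height_of_lift hφ1 hφi (affine_mem_Ioo hm hkm hp)
    rw [show height φ ((fun p : ℝ × ℝ => φ (p.1, k + m * p.2)) p) = k + m * p.2 from e,
      add_sub_cancel_left, mul_div_cancel_left₀ _ hm.ne']
  · have hk := abs_le.1 (show |k| ≤ 1 - m by linarith)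
    rw [height_of_not_mem hA, exp_clampStep_eq_one (by rw [abs_neg, abs_one]; norm_num),
      exp_clampStep_eq_one]
    -- the height of `K e^{2πit}` in `φ` is at distance `≥ m` from `k`, or `−1`
    by_cases hA' : K (circlePt t) ∈ φ '' (univ ×ˢ Ioo (-1 : ℝ) 1)
    · obtain ⟨p, ⟨-, hp⟩, hpq⟩ := hA'
      rw [← hpq, height_of_lift hφ1 hφi (u₀ := p.1) (r₀ := p.2) hp]
      have hge : m ≤ |p.2 - k| := by
        by_contra hlt
        push Not at hlt
        refine hA ⟨(p.1, (p.2 - k) / m), ⟨trivial, ?_⟩, ?_⟩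
        · rw [abs_lt] at hlt
          constructor
          · rw [lt_div_iff₀ hm]; linarith
          · rw [div_lt_iff₀ hm]; linarith
        · show φ (p.1, k + m * ((p.2 - k) / m)) = K (circlePt t)
          rw [mul_div_cancel₀ _ hm.ne', add_sub_cancel, Prod.mk.eta, hpq]
      rw [abs_div, abs_of_pos hm, le_div_iff₀ hm]
      linarith
    · rw [height_of_not_mem hA', abs_div, abs_of_pos hm, le_div_iff₀ hm,
        abs_of_neg (by linarith)]
      linarith

/-! ## §3 Joint continuity of the family of phase loops -/

/-- The image of a horizontal closed strip `ℝ × [r₁, r₂]` by a periodic continuous chart is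
compact. [folklore] -/
theorem isCompact_image_Icc (hφc : Continuous φ) (hφ1 : ∀ u r, φ (u + 1, r) = φ (u, r))
    (r₁ r₂ : ℝ) : IsCompact (φ '' (univ ×ˢ Icc r₁ r₂)) := by
  have e : φ '' (univ ×ˢ Icc r₁ r₂) = φ '' (Icc (0 : ℝ) 1 ×ˢ Icc r₁ r₂) := by
    refine Subset.antisymm ?_ (image_mono (prod_mono (subset_univ _) Subset.rfl))
    rintro _ ⟨p, ⟨-, hp⟩, rfl⟩
    exact ⟨(Int.fract p.1, p.2), ⟨⟨Int.fract_nonneg _, (Int.fract_lt_one _).le⟩, hp⟩,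
      chart_fract hφ1 p⟩
  rw [e]
  exact (isCompact_Icc.prod isCompact_Icc).image hφc

/-- Off the strip `φ(ℝ × [−1 + δ, 1 − δ])` the height is within `δ` of `±1`, or the point is off
the open annulus. [folklore] -/
theorem height_cases_of_not_mem_strip {δ : ℝ} {q : Base g}
    (hq : q ∉ φ '' (univ ×ˢ Icc (-1 + δ) (1 - δ))) :
    (q ∈ φ '' (univ ×ˢ Ioo (-1 : ℝ) 1) ∧ (height φ q < -1 + δ ∨ 1 - δ < height φ q)) ∨
      q ∉ φ '' (univ ×ˢ Ioo (-1 : ℝ) 1) := by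
  by_cases hA : q ∈ φ '' (univ ×ˢ Ioo (-1 : ℝ) 1)
  · refine Or.inl ⟨hA, ?_⟩
    obtain ⟨-, hq'⟩ := prelift_spec hA
    by_contra h
    push Not at h
    exact hq ⟨prelift φ q, ⟨trivial, h.1, h.2⟩, hq'⟩
  · exact Or.inr hA

/-- **The family `(μ, t) ↦ exp (2πi χ((height φ (K e^{2πit}) − μk) / (1 − μ(1 − m))))` is jointly
continuous on `[0, 1] × ℝ`** for a loop `K` of the page (`0 < m`, `|k| + m ≤ 1`). [folklore] -/
theorem continuousOn_reprofileFamily (hc : ‖c‖ = 1) (hφc : Continuous φ)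
    (hφ1 : ∀ u r, φ (u + 1, r) = φ (u, r)) (hφp : ∀ p, φ p ∈ page g c)
    (hφi : InjOn φ (Ico (0 : ℝ) 1 ×ˢ Ioo (-1 : ℝ) 1)) (hK : Continuous K)
    (hKc : ∀ θ, K θ ∈ page g c) {k m : ℝ} (hm : 0 < m) (hkm : |k| + m ≤ 1) :
    ContinuousOn (fun q : ℝ × ℝ =>
      Complex.exp (((2 * π * clampStep ((height φ (K (circlePt q.2)) - q.1 * k) /
        (1 - q.1 * (1 - m))) : ℝ) : ℂ) * Complex.I)) (Icc (0 : ℝ) 1 ×ˢ univ) := by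
  have hL : Continuous fun t : ℝ => K (circlePt t) := hK.comp continuous_circlePt
  have hk := abs_le.1 (show |k| ≤ 1 - m by linarith)
  have hm1 : m ≤ 1 := by linarith [abs_nonneg k]
  rintro ⟨μ₀, t₀⟩ ⟨⟨hμ₀, hμ₁⟩, -⟩
  have hden : 0 < 1 - μ₀ * (1 - m) := by nlinarith
  by_cases hA : K (circlePt t₀) ∈ φ '' (univ ×ˢ Ioo (-1 : ℝ) 1)
  · -- inside the open annulus: the height is continuous along the loop near `t₀`
    have hh : ContinuousAt (fun t : ℝ => height φ (K (circlePt t))) t₀ := by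
      have h1 := continuousWithinAt_height hc hφc hφ1 hφp hφi hA
      have h2 : ContinuousWithinAt (fun t : ℝ => K (circlePt t)) univ t₀ :=
        hL.continuousAt.continuousWithinAt
      have h3 := ContinuousWithinAt.comp (f := fun t : ℝ => K (circlePt t)) (x := t₀) h1 h2
        (fun t _ => hKc _)
      exact h3.continuousAt univ_mem
    have hq : ContinuousAt (fun q : ℝ × ℝ =>
        (height φ (K (circlePt q.2)) - q.1 * k) / (1 - q.1 * (1 - m))) (μ₀, t₀) :=
      ((hh.comp_of_eq continuousAt_snd rfl).sub (continuousAt_fst.mul continuousAt_const)).div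
        (continuousAt_const.sub (continuousAt_fst.mul continuousAt_const)) hden.ne'
    have h4 : ContinuousAt (fun q : ℝ × ℝ =>
        ((2 * π * clampStep ((height φ (K (circlePt q.2)) - q.1 * k) /
          (1 - q.1 * (1 - m))) : ℝ) : ℂ) * Complex.I) (μ₀, t₀) :=
      (Complex.continuous_ofReal.continuousAt.comp
        (continuousAt_const.mul (continuous_clampStep.continuousAt.comp hq))).mul
        continuousAt_const
    exact (Complex.continuous_exp.continuousAt.comp h4).continuousWithinAt
  · -- off the open annulus: off the compact strip `φ(ℝ × [−1 + m/2, 1 − m/2])` nearby, where the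
    -- phase of every stage is `1`
    have hB : K (circlePt t₀) ∉ φ '' (univ ×ˢ Icc (-1 + m / 2) (1 - m / 2)) := fun h =>
      hA (image_mono (Set.prod_mono Subset.rfl (Icc_subset_Ioo (by linarith) (by linarith))) h)
    have hV : IsOpen ((fun t : ℝ => K (circlePt t)) ⁻¹' (φ '' (univ ×ˢ Icc (-1 + m / 2) (1 - m / 2)))ᶜ) :=
      ((isCompact_image_Icc hφc hφ1 _ _).isClosed.preimage hL).isOpen_compl
    have hN : (univ : Set ℝ) ×ˢ ((fun t : ℝ => K (circlePt t)) ⁻¹'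
        (φ '' (univ ×ˢ Icc (-1 + m / 2) (1 - m / 2)))ᶜ) ∈ 𝓝 (μ₀, t₀) :=
      (isOpen_univ.prod hV).mem_nhds ⟨mem_univ _, hB⟩
    have key : ∀ q : ℝ × ℝ, q ∈ (univ : Set ℝ) ×ˢ ((fun t : ℝ => K (circlePt t)) ⁻¹'
        (φ '' (univ ×ˢ Icc (-1 + m / 2) (1 - m / 2)))ᶜ) → q ∈ Icc (0 : ℝ) 1 ×ˢ (univ : Set ℝ) →
        Complex.exp (((2 * π * clampStep ((height φ (K (circlePt q.2)) - q.1 * k) /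
          (1 - q.1 * (1 - m))) : ℝ) : ℂ) * Complex.I) = 1 := by
      rintro ⟨μ, t⟩ ⟨-, hq2⟩ ⟨⟨hμ0, hμ1⟩, -⟩
      have hd : 0 < 1 - μ * (1 - m) := by nlinarith
      have hdm : m ≤ 1 - μ * (1 - m) := by nlinarith
      apply exp_clampStep_eq_one
      rw [abs_div, abs_of_pos hd, le_div_iff₀ hd]
      show 1 / 2 * (1 - μ * (1 - m)) ≤ |height φ (K (circlePt t)) - μ * k|
      rcases height_cases_of_not_mem_strip hq2 with ⟨-, hr | hr⟩ | hA'
      · rw [abs_of_neg (by nlinarith)]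
        nlinarith
      · rw [abs_of_pos (by nlinarith)]
        nlinarith
      · rw [height_of_not_mem hA', abs_of_neg (by nlinarith)]
        nlinarith
    refine (continuousWithinAt_const (b := (1 : ℂ))).congr_of_eventuallyEq ?_
      (key _ ⟨mem_univ _, hB⟩ ⟨⟨hμ₀, hμ₁⟩, mem_univ _⟩)
    filter_upwards [mem_nhdsWithin_of_mem_nhds hN, self_mem_nhdsWithin] with q hq hqs
    exact key q hq hqs

/-! ## §4 The theorem -/

/-- **Re-profiling the chart does not change crossing numbers**: for `0 < m`, `|k| + m ≤ 1` and
every loop `K` of the page, `crossingNumber φ_{k,m} K = crossingNumber φ K`,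
`φ_{k,m} (u, r) = φ (u, k + m r)`. [cite: Fulton1995, §3] -/
theorem crossingNumber_reprofile (hc : ‖c‖ = 1) (hφc : Continuous φ)
    (hφ1 : ∀ u r, φ (u + 1, r) = φ (u, r)) (hφp : ∀ p, φ p ∈ page g c)
    (hφi : InjOn φ (Ico (0 : ℝ) 1 ×ˢ Ioo (-1 : ℝ) 1)) (hK : Continuous K)
    (hKc : ∀ θ, K θ ∈ page g c) {k m : ℝ} (hm : 0 < m) (hkm : |k| + m ≤ 1) :
    crossingNumber (fun p : ℝ × ℝ => φ (p.1, k + m * p.2)) K = crossingNumber φ K := by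
  -- the family `μ ↦ (k_μ, m_μ) = (μ k, 1 − μ (1 − m))` from `(0, 1)` to `(k, m)`
  set F : ℝ → ℝ → ℂ := fun μ t => Complex.exp (((2 * π *
    clampStep ((height φ (K (circlePt t)) - μ * k) / (1 - μ * (1 - m))) : ℝ) : ℂ) * Complex.I)
    with hF
  have hcont : ContinuousOn (uncurry F) (Icc (0 : ℝ) 1 ×ˢ Icc (0 : ℝ) 1) :=
    (continuousOn_reprofileFamily hc hφc hφ1 hφp hφi hK hKc hm hkm).mono
      (Set.prod_mono Subset.rfl (subset_univ _))
  have hloop : ∀ μ ∈ Icc (0 : ℝ) 1, F μ 0 = F μ 1 := fun μ _ => by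
    simp only [hF, ← circlePt_add_one 0, zero_add]
  have hne : ∀ μ ∈ Icc (0 : ℝ) 1, ∀ t ∈ Icc (0 : ℝ) 1, F μ t ≠ 0 := fun μ _ t _ =>
    Complex.exp_ne_zero _
  have hwind := wind_eq_of_homotopy hcont hloop hne
  have e0 : F 0 = phaseLoop φ K := by
    funext t
    simp only [hF, zero_mul, sub_zero, div_one]
    rfl
  have e1 : F 1 = phaseLoop (fun p : ℝ × ℝ => φ (p.1, k + m * p.2)) K := by
    funext t
    rw [phaseLoop_reprofile hφ1 hφi hm hkm]
    simp only [hF, one_mul, sub_sub_cancel]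
  rw [crossingNumber, crossingNumber, ← e0, ← e1, hwind]

/-- **Shrinking the collar does not change crossing numbers**: for `0 < ε ≤ 1` and every loop
`K` of the page, `crossingNumber φ_ε K = crossingNumber φ K`, `φ_ε (u, r) = φ (u, ε r)`.
[cite: Fulton1995, §3] -/
theorem crossingNumber_rescale (hc : ‖c‖ = 1) (hφc : Continuous φ)
    (hφ1 : ∀ u r, φ (u + 1, r) = φ (u, r)) (hφp : ∀ p, φ p ∈ page g c)
    (hφi : InjOn φ (Ico (0 : ℝ) 1 ×ˢ Ioo (-1 : ℝ) 1)) (hK : Continuous K)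
    (hKc : ∀ θ, K θ ∈ page g c) {ε : ℝ} (hε : 0 < ε) (hε1 : ε ≤ 1) :
    crossingNumber (fun p : ℝ × ℝ => φ (p.1, ε * p.2)) K = crossingNumber φ K := by
  have h := crossingNumber_reprofile hc hφc hφ1 hφp hφi hK hKc (k := 0) hε
    (by rw [abs_zero, zero_add]; exact hε1)
  simpa only [zero_add] using h

/-! ## §5 The registered form -/

/-- **Sub-goal `helper_crossingNumber_reprofile`** (Z6-5, a tool for the evaluation step of the
missing lemma of node N1a of NF4): re-profiling an annulus chart of a page by an increasing affine
map of the transverse coordinate (`φ_{k,m} (u, r) = φ (u, k + m r)`, `0 < m`, `|k| + m ≤ 1`: collar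
shrunk and recentred at the level `height = k`) does not change the crossing number of any loop
of the page. [cite: Fulton1995, §3] -/
theorem helper_crossingNumber_reprofile : ∀ (g : ℕ) (c : ℂ) (_hc : ‖c‖ = 1) (φ : ℝ × ℝ → Literature.Topology.FourManifolds.LefschetzBase.Base g) (_hφc : Continuous φ) (_hφ1 : ∀ u r, φ (u + 1, r) = φ (u, r)) (_hφp : ∀ p, φ p ∈ Literature.Topology.FourManifolds.LefschetzBase.page g c) (_hφi : Set.InjOn φ (Set.Ico (0 : ℝ) 1 ×ˢ Set.Ioo (-1 : ℝ) 1)) (K : Metric.sphere (0 : EuclideanSpace ℝ (Fin 2)) 1 → Literature.Topology.FourManifolds.LefschetzBase.Base g) (_hK : Continuous K) (_hKc : ∀ θ, K θ ∈ Literature.Topology.FourManifolds.LefschetzBase.page g c) (k m : ℝ), 0 < m → |k| + m ≤ 1 → Summit.SmoothPoincare4.SmoothPoincare4.Theorems.AcyclicBisectionExists.ModpBraidOrbits.crossingNumber (fun p : ℝ × ℝ => φ (p.1, k + m * p.2)) K = Summit.SmoothPoincare4.SmoothPoincare4.Theorems.AcyclicBisectionExists.ModpBraidOrbits.crossingNumber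 φ K :=
  fun _ _ hc _ hφc hφ1 hφp hφi _ hK hKc _ _ hm hkm =>
    crossingNumber_reprofile hc hφc hφ1 hφp hφi hK hKc hm hkm

end Summit.SmoothPoincare4.SmoothPoincare4.Theorems.AcyclicBisectionExists.ModpBraidOrbits

end
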